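import Summits.BirchSwinnertonDyer.Rank1Residual.X11b.Three.HsiehDescentOfValueReciprocity
import HarnessLib

/-!
# X11b @ `p = 3`, S30: the value-reciprocity DICTIONARY — (VR) re-expressed on the normalized
# Rankin–Selberg central values `L(f/K, χ, 1)/(π^{2n+1}·Ω^{4n})`

HONEST FRAMING (cell `b2b-bsdres`, run/shared/lean/b2b/bsd-rank1-residual/, verbatim in every
file): the goal of the cell is to DELETE the COMBINATION-SHAPED residual classes of the
Birch–Swinnerton-Dyer formula for ALL analytic-rank `≤ 1` elliptic curves over `ℚ` — assembled
STRICTLY from published theorems — so that the rank-`≤ 1` remainder becomes exactly the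
CONSTRUCTION-SHAPED classes, which are TYPED, NOT attempted. This is not "finishing BSD". Team N8/O2
(X11b at `3`); deal S30 (x11b3-lead GEN 9, OWNERS R10-5: "is κ termwise equivariant?" — S30-c),
seat `b2b-bsdres-x11b3-p1` (gen. 4). **WORDING OF RECORD (H45): S29 RE-EXPRESSES (t) ⟸ (VR); this file
RE-EXPRESSES (VR) on the bare normalized central values.** Nothing is discharged: the reciprocity
statements for the normalized values enter as EXPLICIT LABELLED HYPOTHESES; they are NOT published
numbered statements in this form and NOT Literature facts. The node `Three.HsiehDescentAt₃` is
UNCHANGED (no `_holds`, nothing appended); O2 OPEN / N8 CONSTRUCTION; nothing booked; no mark / label /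
count / tier moved. THEOREMS ONLY (no definition, no named fact, no `sorry`).

## What this file proves

The tree's interpolation value (Castella 2018, Thm. 3.1) is
`M(χ, n; Ω) = bdpInterpolationValue p f 𝔭 χ n Ω = κ_𝔭(χ, n) · A(χ, n; Ω)` with the ELEMENTARY FACTOR
`κ_𝔭(χ, n) = Γ(n)Γ(n+1) · (1 − a_p p⁻¹ χ(𝔭) + ε_p χ(𝔭)²)²` and the NORMALIZED CENTRAL VALUE
`A(χ, n; Ω) = L(f/K, χ, 1) / (π^{2n+1} · Ω^{4n})` (`rankinSelbergValueHecke f χ 1 / …`; no definition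
is introduced — the quotient is written out).

* `algEquiv_apply_Gamma_nat`, `algEquiv_apply_heckeValueExtZero`, `algEquiv_apply_eulerFactorSq` —
  **the elementary factor is TERMWISE `Aut(ℂ)`-EQUIVARIANT**: for EVERY `σ ∈ Aut(ℂ)` and every Hecke
  character `χ` of some infinity type, `σ κ_𝔭(χ, n) = κ_𝔭(^σχ, n)` — `Γ(n)Γ(n+1) ∈ ℕ`, `a_p ∈ ℤ`
  (hypothesis `∃ a : ℤ, a_p(f) = a`, supplied by `IsNewformOf W f`), `σ(χ(𝔭)) = (^σχ)(𝔭)` (Weil 1956: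
  tree `HasInfinityType.valueAtUniformizer_autConj`, `isUnramifiedAt_autConj_iff`).
* `algEquiv_apply_bdpInterpolationValue` — **THE DICTIONARY**:
  `σ M(χ, n; Ω) = κ_𝔭(^σχ, n) · σ A(χ, n; Ω)` for every `σ ∈ Aut(ℂ)`.
* `bdpInterpolationValue_exact_of_normalizedValue_exact` /
  `bdpInterpolationValue_cocycle_of_normalizedValue_cocycle` — pointwise: exactness (resp. the cocycle
  identity with constants `(c, d, e)`) of `A` under `σ` implies the same for `M`, same constants.
* `valueReciprocity_of_normalizedValueReciprocity` — **(VR_norm) ⟹ (VR), kernel**: (VR_norm) = the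
  hypothesis of record `hVR` of p287576 with `bdpInterpolationValue 3 f 𝔭 χ n Ω` replaced everywhere by
  `A(χ, n; Ω) = L(f/K, χ, 1)/(π^{2n+1}·Ω^{4n})` (one `∃ Ω ≠ 0`; (VR-A_norm) cocycle clause on
  `Aut(ℂ/K)`, (VR-B_norm) exactness on `Aut(ℂ/F)`, `F ⊇ K` unramified above `3`); conclusion = `hVR`
  VERBATIM; same `Ω`, `F`, `(c, d, e)`.
* `hsiehDescentAt₃_of_normalizedValueReciprocity` — END FORM: `HsiehDescentAt₃ W` from (VR_norm), via
  `hsiehDescentAt₃_of_valueReciprocity'` (x11b3-p7, p287576) by name. WORDING OF RECORD (R10-18):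
  RE-EXPRESSES (t) ⟸ (VR_norm) = (VR) on the bare normalized Rankin–Selberg central values;
  (VR_norm) ⟹ (VR) kernel; OPEN; nothing discharged.

What this isolates (S30-c): of the constant `κ(χ, n)` of the planner's dictionary
`M = κ·(Σ χ⁻¹(𝔞)·Θ^{n−1}f(𝔞⋆(A,t,ω)))²` (r1 `S30-VR-SPLIT.md` §2), the TREE-VISIBLE part
`Γ(n)Γ(n+1)·E_𝔭(χ)²` is termwise equivariant by the kernel; what remains for print ([T1]
Bertolini–Darmon–Prasanna 2013 Prop. 1.12 (1) + (5.1.16) + Thm. 5.4 + Lemma 5.3 — lit1 L90; Brooks 2015 Prop.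
8.7; [T2] Shimura 1976 / Hida–Tilouine 1993 Thm. 1.1) is EXACTLY the behaviour of `L(f/K, χ, 1)/(π^{2n+1}·Ω^{4n})` under `Aut(ℂ/K)` — the
currency in which those theorems are printed (`L_alg ∈ ℚ̄`). (VR_norm) is not asserted.

References: [Castella2018] Thm. 3.1 (the value); [Weil1956] §1 (`^σχ`); [BertoliniDarmonPrasanna2013]
Prop. 1.12 (1), (5.1.16), Thm. 5.4, Lemma 5.3 (lit1 L90); [HidaTilouine1993] Thm. 1.1; Shimura, Comm. Pure Appl. Math. 29 (1976) Thm. 4 (prose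
reference); cell files OWNERS R10-5, r1 `S30-VR-SPLIT.md` §2, r2 S30-c.
-/

noncomputable section

open scoped NumberField
open NumberField IsDedekindDomain Field WeierstrassCurve
open Literature.NumberTheory.GaloisRepresentations Literature.NumberTheory.EllipticCurves
open Literature.NumberTheory.EllipticCurves.ModularForms

namespace Summit.BirchSwinnertonDyer.Rank1Residual.X11b.Three

/-! ### §1. The elementary factor is termwise `Aut(ℂ)`-equivariant -/

section Elementary

variable {K : Type} [Field K] [NumberField K] {N : ℕ}

/-- `σ(Γ(n)) = Γ(n)` for a natural number `n` and any `σ ∈ Aut(ℂ)`: `Γ(0) = 0` (junk value) and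
`Γ(m+1) = m! ∈ ℕ`. [folklore] -/
theorem algEquiv_apply_Gamma_nat (σ : ℂ ≃ₐ[ℚ] ℂ) (n : ℕ) :
    σ (Complex.Gamma n) = Complex.Gamma n := by
  cases n with
  | zero => rw [Nat.cast_zero, Complex.Gamma_zero, map_zero]
  | succ m => rw [Nat.cast_succ, Complex.Gamma_nat_eq_factorial, map_natCast]

/-- `σ(Γ(n+1)) = Γ(n+1) = n!` for a natural number `n` and any `σ ∈ Aut(ℂ)`. [folklore] -/
theorem algEquiv_apply_Gamma_nat_succ (σ : ℂ ≃ₐ[ℚ] ℂ) (n : ℕ) :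
    σ (Complex.Gamma (n + 1)) = Complex.Gamma (n + 1) := by
  rw [Complex.Gamma_nat_eq_factorial, map_natCast]

/-- **`σ(χ(𝔭)) = (^σχ)(𝔭)` for the value extended by zero** (Weil 1956, §1: `(^σχ)(ϖ_v) = σ(χ(ϖ_v))`
and `^σχ` is unramified at `v` iff `χ` is; at a ramified `v` both sides are `0`).
[cite: Weil1956, §1] -/
theorem algEquiv_apply_heckeValueExtZero {χ : HeckeCharacter K} {p q : InfinitePlace K → ℤ}
    (hχ : χ.HasInfinityType p q) (σ : ℂ ≃ₐ[ℚ] ℂ) (v : HeightOneSpectrum (𝓞 K)) :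
    σ (heckeValueExtZero χ v) = heckeValueExtZero (hχ.autConj σ) v := by
  by_cases hv : χ.IsUnramifiedAt v
  · rw [heckeValueExtZero_of_isUnramifiedAt hv,
      heckeValueExtZero_of_isUnramifiedAt ((hχ.isUnramifiedAt_autConj_iff σ v).mpr hv),
      hχ.valueAtUniformizer_autConj]
  · rw [heckeValueExtZero_of_not_isUnramifiedAt hv,
      heckeValueExtZero_of_not_isUnramifiedAt (mt (hχ.isUnramifiedAt_autConj_iff σ v).mp hv),
      map_zero]

/-- **The squared Euler-type factor `E_𝔭(χ)² = (1 − a_p p⁻¹ χ(𝔭) + ε_p χ(𝔭)²)²` is `Aut(ℂ)`-EQUIVARIANT**: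
`σ(E_𝔭(χ)²) = E_𝔭(^σχ)²`, for every `σ ∈ Aut(ℂ)`, provided `a_p ∈ ℤ` (`ε_p ∈ {0, p⁻¹}` is rational).
[cite: Castella2018, Thm. 3.1 (arXiv:1704.06608 p. 9) (the factor)] [cite: Weil1956, §1] -/
theorem algEquiv_apply_eulerFactorSq (p : ℕ) {f : CuspForm (CongruenceSubgroup.Gamma0 N) 2}
    (ha : ∃ a : ℤ, cuspCoeff f p = a) {χ : HeckeCharacter K} {p' q' : InfinitePlace K → ℤ}
    (hχ : χ.HasInfinityType p' q') (σ : ℂ ≃ₐ[ℚ] ℂ) (𝔭 : HeightOneSpectrum (𝓞 K)) (ε : ℚ) :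
    σ ((1 - cuspCoeff f p * ((p : ℂ))⁻¹ * heckeValueExtZero χ 𝔭 +
          (ε : ℂ) * heckeValueExtZero χ 𝔭 ^ 2) ^ 2) =
      (1 - cuspCoeff f p * ((p : ℂ))⁻¹ * heckeValueExtZero (hχ.autConj σ) 𝔭 +
          (ε : ℂ) * heckeValueExtZero (hχ.autConj σ) 𝔭 ^ 2) ^ 2 := by
  obtain ⟨a, ha⟩ := ha
  rw [map_pow, map_add, map_sub, map_one, map_mul, map_mul, map_mul, map_pow, map_inv₀,
    map_natCast, ha, map_intCast, map_ratCast, algEquiv_apply_heckeValueExtZero hχ]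

/-- The `ε_p` of the tree's value is rational: `ε_p = 0` if `p ∣ N`, else `p⁻¹`. [folklore] -/
theorem epsilon_eq_ratCast (p : ℕ) :
    (if p ∣ N then (0 : ℂ) else ((p : ℂ))⁻¹) =
      ((if p ∣ N then (0 : ℚ) else ((p : ℚ))⁻¹ : ℚ) : ℂ) := by
  split_ifs <;> simp

/-- **THE DICTIONARY**: for EVERY `σ ∈ Aut(ℂ)`, every Hecke character `χ` of some infinity type and
every period `Ω`,
`σ M(χ, n; Ω) = Γ(n)Γ(n+1) · E_𝔭(^σχ)² · σ( L(f/K, χ, 1) / (π^{2n+1}·Ω^{4n}) )` — the elementary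
factor passes through `σ` onto the conjugate character, and ALL of (VR) is carried by the normalized
central value `A(χ, n; Ω) = L(f/K, χ, 1)/(π^{2n+1}·Ω^{4n})`. Hypothesis: `a_p ∈ ℤ`.
[cite: Castella2018, Thm. 3.1 (arXiv:1704.06608 p. 9)] [cite: Weil1956, §1] -/
theorem algEquiv_apply_bdpInterpolationValue (p : ℕ) {f : CuspForm (CongruenceSubgroup.Gamma0 N) 2}
    (ha : ∃ a : ℤ, cuspCoeff f p = a) (𝔭 : HeightOneSpectrum (𝓞 K)) {χ : HeckeCharacter K}
    {p' q' : InfinitePlace K → ℤ} (hχ : χ.HasInfinityType p' q') (n : ℕ) (Ω : ℂ) (σ : ℂ ≃ₐ[ℚ] ℂ) :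
    σ (bdpInterpolationValue p f 𝔭 χ n Ω) =
      Complex.Gamma n * Complex.Gamma (n + 1) *
        (1 - cuspCoeff f p * ((p : ℂ))⁻¹ * heckeValueExtZero (hχ.autConj σ) 𝔭 +
            (if p ∣ N then (0 : ℂ) else ((p : ℂ))⁻¹) * heckeValueExtZero (hχ.autConj σ) 𝔭 ^ 2) ^ 2 *
        σ (rankinSelbergValueHecke f χ 1 / ((Real.pi : ℂ) ^ (2 * n + 1) * Ω ^ (4 * n))) := by
  have hM : bdpInterpolationValue p f 𝔭 χ n Ω =
      Complex.Gamma n * Complex.Gamma (n + 1) *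
        (1 - cuspCoeff f p * ((p : ℂ))⁻¹ * heckeValueExtZero χ 𝔭 +
            (if p ∣ N then (0 : ℂ) else ((p : ℂ))⁻¹) * heckeValueExtZero χ 𝔭 ^ 2) ^ 2 *
        (rankinSelbergValueHecke f χ 1 / ((Real.pi : ℂ) ^ (2 * n + 1) * Ω ^ (4 * n))) := by
    simp only [bdpInterpolationValue]
    ring
  rw [hM, map_mul, map_mul, map_mul, algEquiv_apply_Gamma_nat, algEquiv_apply_Gamma_nat_succ,
    epsilon_eq_ratCast, algEquiv_apply_eulerFactorSq p ha hχ σ 𝔭]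

/-- The value FACTORS as elementary factor times normalized central value:
`M(χ, n; Ω) = κ_𝔭(χ, n) · A(χ, n; Ω)`. [cite: Castella2018, Thm. 3.1 (arXiv:1704.06608 p. 9)] -/
theorem bdpInterpolationValue_eq_elementary_mul_normalizedValue (p : ℕ)
    (f : CuspForm (CongruenceSubgroup.Gamma0 N) 2) (𝔭 : HeightOneSpectrum (𝓞 K)) (χ : HeckeCharacter K)
    (n : ℕ) (Ω : ℂ) :
    bdpInterpolationValue p f 𝔭 χ n Ω =
      Complex.Gamma n * Complex.Gamma (n + 1) *
        (1 - cuspCoeff f p * ((p : ℂ))⁻¹ * heckeValueExtZero χ 𝔭 +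
            (if p ∣ N then (0 : ℂ) else ((p : ℂ))⁻¹) * heckeValueExtZero χ 𝔭 ^ 2) ^ 2 *
        (rankinSelbergValueHecke f χ 1 / ((Real.pi : ℂ) ^ (2 * n + 1) * Ω ^ (4 * n))) := by
  simp only [bdpInterpolationValue]
  ring

/-- **Pointwise EXACTNESS transfer**: if `σ` is exact on the normalized central value,
`σ A(χ, n; Ω) = A(^σχ, n; Ω)`, then `σ` is exact on the interpolation value,
`σ M(χ, n; Ω) = M(^σχ, n; Ω)`. Hypothesis `a_p ∈ ℤ`. [cite: Castella2018, Thm. 3.1] [cite: Weil1956, §1] -/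
theorem bdpInterpolationValue_exact_of_normalizedValue_exact (p : ℕ)
    {f : CuspForm (CongruenceSubgroup.Gamma0 N) 2} (ha : ∃ a : ℤ, cuspCoeff f p = a)
    (𝔭 : HeightOneSpectrum (𝓞 K)) {χ : HeckeCharacter K} {p' q' : InfinitePlace K → ℤ}
    (hχ : χ.HasInfinityType p' q') (n : ℕ) (Ω : ℂ) (σ : ℂ ≃ₐ[ℚ] ℂ)
    (hA : σ (rankinSelbergValueHecke f χ 1 / ((Real.pi : ℂ) ^ (2 * n + 1) * Ω ^ (4 * n))) =
      rankinSelbergValueHecke f (hχ.autConj σ) 1 / ((Real.pi : ℂ) ^ (2 * n + 1) * Ω ^ (4 * n))) :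
    σ (bdpInterpolationValue p f 𝔭 χ n Ω) = bdpInterpolationValue p f 𝔭 (hχ.autConj σ) n Ω := by
  rw [algEquiv_apply_bdpInterpolationValue p ha 𝔭 hχ n Ω σ, hA,
    bdpInterpolationValue_eq_elementary_mul_normalizedValue p f 𝔭 (hχ.autConj σ) n Ω]

/-- **Pointwise COCYCLE transfer**: if `σ A(χ, n; Ω) = D · A(^σχ, n; Ω)` for some constant `D` (in
(VR-A): `D = d·cⁿ·∏_v (^σχ)(ϖ_v)^{e_v}`), then `σ M(χ, n; Ω) = D · M(^σχ, n; Ω)` with the SAME `D`.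
Hypothesis `a_p ∈ ℤ`. [cite: Castella2018, Thm. 3.1] [cite: Weil1956, §1] -/
theorem bdpInterpolationValue_cocycle_of_normalizedValue_cocycle (p : ℕ)
    {f : CuspForm (CongruenceSubgroup.Gamma0 N) 2} (ha : ∃ a : ℤ, cuspCoeff f p = a)
    (𝔭 : HeightOneSpectrum (𝓞 K)) {χ : HeckeCharacter K} {p' q' : InfinitePlace K → ℤ}
    (hχ : χ.HasInfinityType p' q') (n : ℕ) (Ω D : ℂ) (σ : ℂ ≃ₐ[ℚ] ℂ)
    (hA : σ (rankinSelbergValueHecke f χ 1 / ((Real.pi : ℂ) ^ (2 * n + 1) * Ω ^ (4 * n))) =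
      D * (rankinSelbergValueHecke f (hχ.autConj σ) 1 / ((Real.pi : ℂ) ^ (2 * n + 1) * Ω ^ (4 * n)))) :
    σ (bdpInterpolationValue p f 𝔭 χ n Ω) = D * bdpInterpolationValue p f 𝔭 (hχ.autConj σ) n Ω := by
  rw [algEquiv_apply_bdpInterpolationValue p ha 𝔭 hχ n Ω σ, hA,
    bdpInterpolationValue_eq_elementary_mul_normalizedValue p f 𝔭 (hχ.autConj σ) n Ω]
  ring

/-- `a_p(f) ∈ ℤ` for the newform of a Weierstrass curve over `ℚ`: `a_n(f) = a_n(W)`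
(`IsNewformOf`). [cite: BreuilConradDiamondTaylor2001, Thm. A] -/
theorem exists_int_cuspCoeff_eq_of_isNewformOf {W : WeierstrassCurve ℚ} [NeZero N]
    {f : CuspForm (CongruenceSubgroup.Gamma0 N) 2} (hf : IsNewformOf W f) (p : ℕ) :
    ∃ a : ℤ, cuspCoeff f p = a :=
  ⟨W.LFunction p, hf.2 p⟩

end Elementary

/-! ### §2. (VR_norm) ⟹ (VR) in the kernel, and the END FORM -/

section EndForm

variable (W : WeierstrassCurve ℚ)

/-- **(VR_norm) ⟹ (VR) — kernel.** (VR_norm) is the hypothesis of record (VR) (= `hVR` of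
`hsiehDescentAt₃_of_valueReciprocity'`, x11b3-p7 p287576, binder v3 of x11b3-r1) with the interpolation
value `bdpInterpolationValue 3 f 𝔭 χ n Ω` replaced EVERYWHERE by the bare normalized Rankin–Selberg
central value `A(χ, n; Ω) = rankinSelbergValueHecke f χ 1 / (π^(2n+1) · Ω^(4n))` and nothing else
changed (same node-data binders, ONE `∃ Ω ≠ 0`, (VR-A_norm) the cocycle clause on `Aut(ℂ/K)` with the
same constants `c, d` and ideal monomial `e`, (VR-B_norm) exactness on `Aut(ℂ/F)`, `F ⊇ K` unramified
above `3`); the conclusion is (VR) VERBATIM. Proof = the dictionary pointwise (`a₃ ∈ ℤ` by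
`IsNewformOf`; `bdpInterpolationValue_cocycle_of_normalizedValue_cocycle`,
`bdpInterpolationValue_exact_of_normalizedValue_exact`), same `Ω`, same `F`, same `(c, d, e)`. The
converse ((VR) ⟹ (VR_norm)) holds wherever `E_𝔭(^σχ) ≠ 0` and is NOT claimed here. (VR_norm) is a
LABELLED HYPOTHESIS in the currency of print ([T1] `L_alg ∈ ℚ̄`), NOT a fact; nothing is discharged.
[cite: Castella2018, Thm. 3.1 (arXiv:1704.06608 p. 9)] [cite: Weil1956, §1]
[cite: BertoliniDarmonPrasanna2013, Prop. 1.12 (1), (5.1.16), Thm. 5.4, Lemma 5.3] -/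
theorem valueReciprocity_of_normalizedValueReciprocity
    (hVRn :
      ∀ (K : Type) [Field K] [NumberField K] (𝔭 : HeightOneSpectrum (𝓞 K)) {N : ℕ} [NeZero N]
        (f : CuspForm (CongruenceSubgroup.Gamma0 N) 2),
        IsNewformOf W f → W.conductorNorm ℤ = N → IsImaginaryQuadratic K → SatisfiesHeegnerHypothesis N K →
        ((Ideal.span {(3 : ℤ)}).primesOver (𝓞 K)).ncard = 2 → ((3 : ℕ) : 𝓞 K) ∈ 𝔭.asIdeal →
        ∃ Ω : ℂ, Ω ≠ 0 ∧
          -- (VR-A_norm) cocycle clause on Aut(ℂ/K) for A(χ, n; Ω) = L(f/K, χ, 1)/(π^{2n+1}·Ω^{4n})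
          (∀ σ : ℂ ≃ₐ[ℚ] ℂ, (∀ (φ : K →+* ℂ) (k : K), σ (φ k) = φ k) →
            ∃ (c d : ℂ) (e : HeightOneSpectrum (𝓞 K) →₀ ℤ), c ≠ 0 ∧ d ≠ 0 ∧
              (∀ v ∈ e.support, ((3 : ℕ) : 𝓞 K) ∉ v.asIdeal) ∧
              ∀ (χ : HeckeCharacter K) (n : ℕ), 0 < n →
                (∀ v : HeightOneSpectrum (𝓞 K), χ.IsUnramifiedAt v) →
                ∀ hχ : χ.HasInfinityType (fun _ ↦ (n : ℤ)) (fun _ ↦ -(n : ℤ)),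
                  σ (rankinSelbergValueHecke f χ 1 / ((Real.pi : ℂ) ^ (2 * n + 1) * Ω ^ (4 * n))) =
                    d * c ^ n * (e.prod fun v k ↦ (hχ.autConj σ).valueAtUniformizer v ^ k) *
                      (rankinSelbergValueHecke f (hχ.autConj σ) 1 /
                        ((Real.pi : ℂ) ^ (2 * n + 1) * Ω ^ (4 * n)))) ∧
          -- (VR-B_norm) exactness clause on Aut(ℂ/F), F ⊇ K a number field unramified above 3
          (∃ F : IntermediateField ℚ ℂ, FiniteDimensional ℚ F ∧
            (∀ (φ : K →+* ℂ) (k : K), φ k ∈ F) ∧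
            (∀ P : Ideal (𝓞 F), P.IsPrime → ((3 : ℕ) : 𝓞 F) ∈ P → P.ramificationIdx (𝓞 ℚ) = 1) ∧
            ∀ σ : ℂ ≃ₐ[ℚ] ℂ, (∀ x : ℂ, x ∈ F → σ x = x) →
              ∀ (χ : HeckeCharacter K) (n : ℕ), 0 < n →
                (∀ v : HeightOneSpectrum (𝓞 K), χ.IsUnramifiedAt v) →
                ∀ hχ : χ.HasInfinityType (fun _ ↦ (n : ℤ)) (fun _ ↦ -(n : ℤ)),
                  σ (rankinSelbergValueHecke f χ 1 / ((Real.pi : ℂ) ^ (2 * n + 1) * Ω ^ (4 * n))) =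
                    rankinSelbergValueHecke f (hχ.autConj σ) 1 /
                      ((Real.pi : ℂ) ^ (2 * n + 1) * Ω ^ (4 * n)))) :
      ∀ (K : Type) [Field K] [NumberField K] (𝔭 : HeightOneSpectrum (𝓞 K)) {N : ℕ} [NeZero N]
        (f : CuspForm (CongruenceSubgroup.Gamma0 N) 2),
        IsNewformOf W f → W.conductorNorm ℤ = N → IsImaginaryQuadratic K → SatisfiesHeegnerHypothesis N K →
        ((Ideal.span {(3 : ℤ)}).primesOver (𝓞 K)).ncard = 2 → ((3 : ℕ) : 𝓞 K) ∈ 𝔭.asIdeal →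
        ∃ Ω : ℂ, Ω ≠ 0 ∧
          -- (VR-A) cocycle clause on Aut(ℂ/K); ideal slot = integer-exponent monomial at primes v ∤ 3 (F-i)
          (∀ σ : ℂ ≃ₐ[ℚ] ℂ, (∀ (φ : K →+* ℂ) (k : K), σ (φ k) = φ k) →
            ∃ (c d : ℂ) (e : HeightOneSpectrum (𝓞 K) →₀ ℤ), c ≠ 0 ∧ d ≠ 0 ∧
              (∀ v ∈ e.support, ((3 : ℕ) : 𝓞 K) ∉ v.asIdeal) ∧
              ∀ (χ : HeckeCharacter K) (n : ℕ), 0 < n →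
                (∀ v : HeightOneSpectrum (𝓞 K), χ.IsUnramifiedAt v) →
                ∀ hχ : χ.HasInfinityType (fun _ ↦ (n : ℤ)) (fun _ ↦ -(n : ℤ)),
                  σ (bdpInterpolationValue 3 f 𝔭 χ n Ω) =
                    d * c ^ n * (e.prod fun v k ↦ (hχ.autConj σ).valueAtUniformizer v ^ k) *
                      bdpInterpolationValue 3 f 𝔭 (hχ.autConj σ) n Ω) ∧
          -- (VR-B) exactness clause on Aut(ℂ/F), F ⊇ K a number field unramified above 3
          (∃ F : IntermediateField ℚ ℂ, FiniteDimensional ℚ F ∧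
            (∀ (φ : K →+* ℂ) (k : K), φ k ∈ F) ∧
            (∀ P : Ideal (𝓞 F), P.IsPrime → ((3 : ℕ) : 𝓞 F) ∈ P → P.ramificationIdx (𝓞 ℚ) = 1) ∧
            ∀ σ : ℂ ≃ₐ[ℚ] ℂ, (∀ x : ℂ, x ∈ F → σ x = x) →
              ∀ (χ : HeckeCharacter K) (n : ℕ), 0 < n →
                (∀ v : HeightOneSpectrum (𝓞 K), χ.IsUnramifiedAt v) →
                ∀ hχ : χ.HasInfinityType (fun _ ↦ (n : ℤ)) (fun _ ↦ -(n : ℤ)),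
                  σ (bdpInterpolationValue 3 f 𝔭 χ n Ω) =
                    bdpInterpolationValue 3 f 𝔭 (hχ.autConj σ) n Ω) := by
  intro K _ _ 𝔭 N _ f hf hN hK hH h2 h𝔭
  have ha : ∃ a : ℤ, cuspCoeff f 3 = a := exists_int_cuspCoeff_eq_of_isNewformOf hf 3
  obtain ⟨Ω, hΩ, ha', F, hFfin, hKF, hFunr, hb⟩ := hVRn K 𝔭 f hf hN hK hH h2 h𝔭
  refine ⟨Ω, hΩ, ?_, ⟨F, hFfin, hKF, hFunr, ?_⟩⟩
  · intro σ hσ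
    obtain ⟨c, d, e, hc, hd, he, hcoc⟩ := ha' σ hσ
    refine ⟨c, d, e, hc, hd, he, fun χ n hn hunr hχ ↦ ?_⟩
    exact bdpInterpolationValue_cocycle_of_normalizedValue_cocycle 3 ha 𝔭 hχ n Ω _ σ
      (hcoc χ n hn hunr hχ)
  · intro σ hσ χ n hn hunr hχ
    exact bdpInterpolationValue_exact_of_normalizedValue_exact 3 ha 𝔭 hχ n Ω σ (hb σ hσ χ n hn hunr hχ)

variable [W.IsElliptic]

/-- **S30 END FORM — `HsiehDescentAt₃ W` from (VR_norm), value reciprocity STATED ON THE BARE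
NORMALIZED RANKIN–SELBERG CENTRAL VALUES `L(f/K, χ, 1)/(π^(2n+1)·Ω^(4n))`.** The ONE hypothesis `hVRn`
is (VR_norm) (text: see `valueReciprocity_of_normalizedValueReciprocity`), EXPLICIT and NOT discharged;
proof = `hsiehDescentAt₃_of_valueReciprocity'` (p287576) ∘ ((VR_norm) ⟹ (VR)). WORDING OF RECORD
(x11b3-lead GEN 9 R10-18): RE-EXPRESSES (t) ⟸ (VR_norm) = (VR) on the bare normalized Rankin–Selberg
central values; (VR_norm) ⟹ (VR) kernel; OPEN; nothing discharged; the node `Three.HsiehDescentAt₃` is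
unchanged; nothing of the class record is supplied. [cite: Hsieh2014, Thm. 1 (arXiv:1112.1580 pp. 3–4)]
[cite: Castella2018, Thm. 3.1] [cite: BertoliniDarmonPrasanna2013, Prop. 1.12 (1), (5.1.16), Thm. 5.4, Lemma 5.3] [cite: Weil1956, §1] -/
theorem hsiehDescentAt₃_of_normalizedValueReciprocity
    (hVRn :
      ∀ (K : Type) [Field K] [NumberField K] (𝔭 : HeightOneSpectrum (𝓞 K)) {N : ℕ} [NeZero N]
        (f : CuspForm (CongruenceSubgroup.Gamma0 N) 2),
        IsNewformOf W f → W.conductorNorm ℤ = N → IsImaginaryQuadratic K → SatisfiesHeegnerHypothesis N K →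
        ((Ideal.span {(3 : ℤ)}).primesOver (𝓞 K)).ncard = 2 → ((3 : ℕ) : 𝓞 K) ∈ 𝔭.asIdeal →
        ∃ Ω : ℂ, Ω ≠ 0 ∧
          -- (VR-A_norm) cocycle clause on Aut(ℂ/K) for A(χ, n; Ω) = L(f/K, χ, 1)/(π^{2n+1}·Ω^{4n})
          (∀ σ : ℂ ≃ₐ[ℚ] ℂ, (∀ (φ : K →+* ℂ) (k : K), σ (φ k) = φ k) →
            ∃ (c d : ℂ) (e : HeightOneSpectrum (𝓞 K) →₀ ℤ), c ≠ 0 ∧ d ≠ 0 ∧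
              (∀ v ∈ e.support, ((3 : ℕ) : 𝓞 K) ∉ v.asIdeal) ∧
              ∀ (χ : HeckeCharacter K) (n : ℕ), 0 < n →
                (∀ v : HeightOneSpectrum (𝓞 K), χ.IsUnramifiedAt v) →
                ∀ hχ : χ.HasInfinityType (fun _ ↦ (n : ℤ)) (fun _ ↦ -(n : ℤ)),
                  σ (rankinSelbergValueHecke f χ 1 / ((Real.pi : ℂ) ^ (2 * n + 1) * Ω ^ (4 * n))) =
                    d * c ^ n * (e.prod fun v k ↦ (hχ.autConj σ).valueAtUniformizer v ^ k) *
                      (rankinSelbergValueHecke f (hχ.autConj σ) 1 /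
                        ((Real.pi : ℂ) ^ (2 * n + 1) * Ω ^ (4 * n)))) ∧
          -- (VR-B_norm) exactness clause on Aut(ℂ/F), F ⊇ K a number field unramified above 3
          (∃ F : IntermediateField ℚ ℂ, FiniteDimensional ℚ F ∧
            (∀ (φ : K →+* ℂ) (k : K), φ k ∈ F) ∧
            (∀ P : Ideal (𝓞 F), P.IsPrime → ((3 : ℕ) : 𝓞 F) ∈ P → P.ramificationIdx (𝓞 ℚ) = 1) ∧
            ∀ σ : ℂ ≃ₐ[ℚ] ℂ, (∀ x : ℂ, x ∈ F → σ x = x) →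
              ∀ (χ : HeckeCharacter K) (n : ℕ), 0 < n →
                (∀ v : HeightOneSpectrum (𝓞 K), χ.IsUnramifiedAt v) →
                ∀ hχ : χ.HasInfinityType (fun _ ↦ (n : ℤ)) (fun _ ↦ -(n : ℤ)),
                  σ (rankinSelbergValueHecke f χ 1 / ((Real.pi : ℂ) ^ (2 * n + 1) * Ω ^ (4 * n))) =
                    rankinSelbergValueHecke f (hχ.autConj σ) 1 /
                      ((Real.pi : ℂ) ^ (2 * n + 1) * Ω ^ (4 * n)))) :
    HsiehDescentAt₃ W :=
  hsiehDescentAt₃_of_valueReciprocity' W (valueReciprocity_of_normalizedValueReciprocity W hVRn)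

end EndForm

end Summit.BirchSwinnertonDyer.Rank1Residual.X11b.Three
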